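import Summits.QuantumFields.BalabanUV.T4Continuum.Support.RegularBackgroundTower
import Summits.QuantumFields.BalabanUV.T4Continuum.Support.CovariantLinePlanting
import Summits.QuantumFields.BalabanUV.T4Continuum.Support.BalabanBlockPoincare

/-!
# T⁴ programme, spine node NE2 (U1a), tier B, row B6′ support item B6′.m3 = (M2′) — THE BLOCK-AVERAGE ∕ PARENT-BOND BRIDGE:
# the two readings of «two-level consistency» of a coefficient tower agree modulo row B5's (3.35)-Lipschitz shape

NE2 formalisation swarm `b2b-balaban-t4-ne2-formalise-*`, leaf prover 05 (gen 4).  HOLDER-LESS support item B6′.m3 of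
`t4/formal/NE2/LEAVES.md` (typer v1.19, booked from `t4/formal/NE2/REFEREE.md` pass 10 c12 and the located currency gap
GAPS § G-ne2leaf08g2-1, item (M2)) = the row owner's item **B8.m2** (OWNER RULING NE2 R17 (d), CLAIMS.log l.12062: «(M2′) bavg∕par bridge:
S-sized bookkeeping under `RegularTransporters.lipschitz` (intra-block oscillation ≤ β/L^k) — booked as item B8.m2, holder-less, any leaf»): node NE3's (E)-road compares the level-`k` object with the BLOCK AVERAGE of the level-`(k+1)`
object over the `L^d` fine bonds above a coarse bond, whereas ROOT B's binder `hNE3 : LocalRate (bgReadings L M 𝒟) C L⁻¹`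
(`Support/NE2FromNE3`) reads, bond by bond, the FINE value against the value at the PARENT bond
(`‖W (k+1) μ x′ − W k μ (parT x′)‖ ≤ β/L^k`, `NE2FromNE3.localRate_of_consistent` / `consistent_of_localRate_lev`).  The difference of the
two readings is the INTRA-BLOCK OSCILLATION of `W (k+1) μ`, which the lattice-Lipschitz SHAPE of row B5's class
(`RegularBackgroundTower.RegularTransporters.lipschitz`: `‖W(x + e_ν) − W(x)‖ ≤ β/L^k` at level `k`) controls.  This file makes that
bookkeeping a kernel statement with explicit constants, for an ABSTRACT tower `W : (k : ℕ) → Fin d → (idx L M k → Matrix o o ℂ)` and then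
for row B5's connection tower `connTower L M R`:
 * §1 oscillation of a lattice-Lipschitz site family along `n` steps (`norm_sub_tstep_le`), along a block offset `off j = Σ_ν j_ν e_ν`
   (`norm_sub_off_le`, ℓ¹-length `Σ_ν j_ν ≤ d·L`), and against the block average `CovariantLinePlanting.bavg` (leaf-02's
   `bavg N R M w (y, μ) = R^{−d} Σ_{x ∈ B(y)} w (x, μ)`): `norm_bavg_sub_le` (an average of vectors each within `B` of `v` is within `B` of `v`);
 * §2 along the tower (`N = lev L k`, `R = L`, so `bavg (lev L k) L M (W (k+1) μ) : idx L M k → M_o(ℂ)` typechecks by `lev L (k+1) ≝ L·lev L k`):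
   **`norm_sub_bavg_parT_le`** `hlip β ⟹ ‖W (k+1) μ x′ − bavg (W (k+1) μ) (parT x′)‖ ≤ 2dβ/lev L k`;
   **`consistent_of_bavg_consistent`** («(E)-reading ⟹ NE2-reading»): `hlip β`, `‖bavg (W (k+1) μ) y − W k μ y‖ ≤ γ/lev L k ⟹
   ‖W (k+1) μ x′ − W k μ (parT x′)‖ ≤ (γ + 2dβ)/lev L k` — EXACTLY the `hcons` shape rows B5/B6 consume;
   **`bavg_consistent_of_consistent`** («NE2-reading ⟹ (E)-reading», NO Lipschitz input): `hcons βc ⟹ ‖bavg (W (k+1) μ) y − W k μ y‖ ≤ βc/lev L k`;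
 * §3 node U1b's currency: **`localRate_of_bavg_consistent`** `⟹ LocalRate (bgReadings L M 𝒟) (γ + 2dβ) L⁻¹` for any class `𝒟` whose members
   carry `hlip β` and the block-average consistency `γ`; conversely **`bavg_consistent_of_localRate`**: ROOT B's binder
   `LocalRate (bgReadings L M 𝒟) C L⁻¹` gives the block-average consistency with constant `2·card o·C` for every member (no Lipschitz needed);
 * §4 row B5's instance: under `RegularTransporters L M R α β` the CONNECTION tower `w = connTower L M R` has `hlip β`
   (`connTower_lipschitz`) ⟹ `connTower_sub_bavg_parT_le`, `connTower_consistent_of_bavg`; for the full class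
   `regClass R = {w, D_νw_ν}` the direction «ROOT B ⟹ block-average reading» holds for BOTH members (`bavg_consistent_regClass_of_localRate`),
   while «block-average reading ⟹ ROOT B's `hNE3`» (`localRate_regClass_of_bavg_consistent`) DISPLAYS an extra Lipschitz bound `hlipD` on the
   derivative tower `D_νw_ν` — a second-difference ∕ (3.36)-type shape that is NOT a field of row B5's `RegularTransporters` (STATED, NOT
   HIDDEN: the bridge closes (M2) for the connection half and LOCATES what the derivative half needs).
WHAT THIS IS NOT.  Not (M1) (ℓ² → sup, `Support/LatticeSupFromEnergy`), not (M3) (inter-level gauge), nothing of node NE3, no identification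
of any tower with Bałaban's minimisers (no B0, trigger c5); ROOT B's conditional status is UNCHANGED.

HONEST FRAMING (T4-DAG p. 1).  Elementary lattice bookkeeping (paths in a block, averages, triangle inequality) on OUR typed towers;
model level, finite torus, operator norm; NE2 (U1a) NOT proved; node NE3 NOT proved; spine PROVED 0/9 unchanged; rung (B)+1 on one finite
T⁴ — NOT infinite volume, NOT mass gap, NOT Clay.  HONEST DEPENDENCY: continuum YM on T⁴ ⇐ BetaPertH ∧ nine spine estimates (0/9 proved);
BetaPertH ⇐ (D1) ∧ (D4) ∧ CAP+tail; G-an2-4 gates asym, D1 and NE2/3/4.  ABSOLUTE RULE kept; no `def … : Prop` fact; no new definition; no `sorry`.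
-/

noncomputable section

open scoped BigOperators Matrix Matrix.Norms.L2Operator

namespace Summit.QuantumFields.BalabanUV.T4Continuum.NE2FromNE3BavgBridge

open Literature.MathematicalPhysics.QuantumFieldTheory.Balaban1983to89.B5Prop11Plancherel (fine Tor unitVec)
open Literature.MathematicalPhysics.QuantumFieldTheory.Balaban1983to89.B5Block118 (tstep tstep_zero tstep_succ)
open Literature.MathematicalPhysics.QuantumFieldTheory.Balaban1983to89.B5G183RateTorus (cpt)
open Literature.MathematicalPhysics.QuantumFieldTheory.Balaban1983to89.B5G183RateTorusW (off)
open Literature.MathematicalPhysics.QuantumFieldTheory.Balaban1983to89.B5G183RateUnitTower (lev lev_neZero)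
open Literature.MathematicalPhysics.QuantumFieldTheory.Balaban1983to89.T4EtaRateMin (LocalRate)
open Summit.QuantumFields.BalabanUV.T4Continuum
open Summit.QuantumFields.BalabanUV.T4Continuum.BalabanAveragedTowerModes (par rem par_cpt_add_off cpt_par_add_off_rem)
open Summit.QuantumFields.BalabanUV.T4Continuum.BalabanAveragedTowerUnit (idx one_le_lev' cast_lev' lev_succ')
open Summit.QuantumFields.BalabanUV.T4Continuum.BlockPairingGeometry (tau parT)
open Summit.QuantumFields.BalabanUV.T4Continuum.BalabanBlockPoincare (off_eq_sum_tstep)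
open Summit.QuantumFields.BalabanUV.T4Continuum.CovariantLinePlanting (bavg)
open Summit.QuantumFields.BalabanUV.T4Continuum.NE2FromNE3 (bgReadings localRate_of_consistent consistent_of_localRate_lev)
open Summit.QuantumFields.BalabanUV.T4Continuum.RegularBackgroundTower (RegularTransporters connTower dconnTower regClass
  connTower_lipschitz lev_pos)

variable {d : ℕ}

/-! ## §1 Oscillation of a lattice-Lipschitz site family: steps, block offsets, block averages -/

section Steps

variable {Nf : Fin d → ℕ} [hNf : ∀ μ, NeZero (Nf μ)] {E : Type*} [SeminormedAddCommGroup E]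

omit hNf in
/-- along `n` unit steps in direction `ν`: `‖f(x + n e_ν, c) − f(x, c)‖ ≤ n·lip`. [folklore] -/
theorem norm_sub_tstep_le (f : Tor Nf × Fin d → E) {lip : ℝ} (hlip : ∀ ν i, ‖f (tau Nf ν i) - f i‖ ≤ lip)
    (x : Tor Nf) (c ν : Fin d) : ∀ n : ℕ, ‖f (x + tstep Nf ν n, c) - f (x, c)‖ ≤ n * lip
  | 0 => by rw [tstep_zero, add_zero, sub_self, norm_zero, Nat.cast_zero, zero_mul]
  | n + 1 => by
    have h1 : ‖f (x + tstep Nf ν n + unitVec Nf ν, c) - f (x + tstep Nf ν n, c)‖ ≤ lip := hlip ν (x + tstep Nf ν n, c)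
    rw [tstep_succ, ← add_assoc]
    calc ‖f (x + tstep Nf ν n + unitVec Nf ν, c) - f (x, c)‖
        ≤ ‖f (x + tstep Nf ν n + unitVec Nf ν, c) - f (x + tstep Nf ν n, c)‖ + ‖f (x + tstep Nf ν n, c) - f (x, c)‖ :=
          norm_sub_le_norm_sub_add_norm_sub _ _ _
      _ ≤ lip + n * lip := add_le_add h1 (norm_sub_tstep_le f hlip x c ν n)
      _ = ((n + 1 : ℕ) : ℝ) * lip := by push_cast; ring

end Steps

section Offsets

variable {N R : ℕ} [NeZero N] [NeZero R] {M : Fin d → ℕ} [hM : ∀ μ, NeZero (M μ)] {E : Type*} [SeminormedAddCommGroup E]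

omit [NeZero N] [NeZero R] hM in
/-- along a partial block offset `Σ_{ν ∈ s} j_ν e_ν`: `‖f(x + Σ_{ν∈s} j_ν e_ν, c) − f(x, c)‖ ≤ (Σ_{ν∈s} j_ν)·lip`. [folklore] -/
theorem norm_sub_sum_tstep_le (f : Tor (fine (R * N) M) × Fin d → E) {lip : ℝ}
    (hlip : ∀ ν i, ‖f (tau (fine (R * N) M) ν i) - f i‖ ≤ lip) (x : Tor (fine (R * N) M)) (c : Fin d) (j : Fin d → Fin R)
    (s : Finset (Fin d)) :
    ‖f (x + ∑ ν ∈ s, tstep (fine (R * N) M) ν (j ν : ℕ), c) - f (x, c)‖ ≤ (∑ ν ∈ s, ((j ν : ℕ) : ℝ)) * lip := by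
  induction s using Finset.induction_on with
  | empty => rw [Finset.sum_empty, Finset.sum_empty, add_zero, sub_self, norm_zero, zero_mul]
  | @insert ν s hν ih =>
    have e : x + ∑ μ ∈ insert ν s, tstep (fine (R * N) M) μ (j μ : ℕ)
        = (x + ∑ μ ∈ s, tstep (fine (R * N) M) μ (j μ : ℕ)) + tstep (fine (R * N) M) ν (j ν : ℕ) := by
      rw [Finset.sum_insert hν, add_assoc, add_comm (tstep _ ν _)]
    rw [e, Finset.sum_insert hν, add_mul]
    calc ‖f (x + ∑ μ ∈ s, tstep (fine (R * N) M) μ (j μ : ℕ) + tstep (fine (R * N) M) ν (j ν : ℕ), c) - f (x, c)‖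
        ≤ ‖f (x + ∑ μ ∈ s, tstep (fine (R * N) M) μ (j μ : ℕ) + tstep (fine (R * N) M) ν (j ν : ℕ), c)
              - f (x + ∑ μ ∈ s, tstep (fine (R * N) M) μ (j μ : ℕ), c)‖
            + ‖f (x + ∑ μ ∈ s, tstep (fine (R * N) M) μ (j μ : ℕ), c) - f (x, c)‖ := norm_sub_le_norm_sub_add_norm_sub _ _ _
      _ ≤ ((j ν : ℕ) : ℝ) * lip + (∑ μ ∈ s, ((j μ : ℕ) : ℝ)) * lip :=
          add_le_add (norm_sub_tstep_le f hlip _ c ν (j ν : ℕ)) ih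

omit [NeZero N] [NeZero R] hM in
/-- the ℓ¹-length of a block offset is at most `d·L`: `Σ_ν j_ν ≤ d·R` (`j_ν < R`). [folklore] -/
theorem sum_off_le (j : Fin d → Fin R) : ∑ ν, ((j ν : ℕ) : ℝ) ≤ d * R := by
  calc ∑ ν : Fin d, ((j ν : ℕ) : ℝ) ≤ ∑ _ν : Fin d, (R : ℝ) := Finset.sum_le_sum fun ν _ => by exact_mod_cast (j ν).isLt.le
    _ = d * R := by rw [Finset.sum_const, Finset.card_univ, Fintype.card_fin, nsmul_eq_mul]

omit [NeZero N] [NeZero R] hM in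
/-- **ALONG A BLOCK OFFSET**: `‖f(x + off j, c) − f(x, c)‖ ≤ d·R·lip` for a lattice-Lipschitz `f` (`0 ≤ lip`). [folklore] -/
theorem norm_sub_off_le (f : Tor (fine (R * N) M) × Fin d → E) {lip : ℝ} (hlip0 : 0 ≤ lip)
    (hlip : ∀ ν i, ‖f (tau (fine (R * N) M) ν i) - f i‖ ≤ lip) (x : Tor (fine (R * N) M)) (c : Fin d) (j : Fin d → Fin R) :
    ‖f (x + off N R M j, c) - f (x, c)‖ ≤ d * R * lip := by
  rw [off_eq_sum_tstep N R M j]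
  exact (norm_sub_sum_tstep_le f hlip x c j Finset.univ).trans (mul_le_mul_of_nonneg_right (sum_off_le j) hlip0)

omit [NeZero N] [NeZero R] hM in
/-- **TWO SITES OF ONE BLOCK** (via the block corner `cpt y`): `‖f(cpt y + off j, c) − f(cpt y + off j′, c)‖ ≤ 2·d·R·lip`. [folklore] -/
theorem norm_sub_of_block_le (f : Tor (fine (R * N) M) × Fin d → E) {lip : ℝ} (hlip0 : 0 ≤ lip)
    (hlip : ∀ ν i, ‖f (tau (fine (R * N) M) ν i) - f i‖ ≤ lip) (y : Tor (fine N M)) (c : Fin d) (j j' : Fin d → Fin R) :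
    ‖f (cpt N R M y + off N R M j, c) - f (cpt N R M y + off N R M j', c)‖ ≤ 2 * (d * R * lip) := by
  calc ‖f (cpt N R M y + off N R M j, c) - f (cpt N R M y + off N R M j', c)‖
      ≤ ‖f (cpt N R M y + off N R M j, c) - f (cpt N R M y, c)‖ + ‖f (cpt N R M y, c) - f (cpt N R M y + off N R M j', c)‖ :=
        norm_sub_le_norm_sub_add_norm_sub _ _ _
    _ ≤ d * R * lip + d * R * lip := by
        refine add_le_add (norm_sub_off_le f hlip0 hlip _ c j) ?_
        rw [norm_sub_rev]; exact norm_sub_off_le f hlip0 hlip _ c j'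
    _ = 2 * (d * R * lip) := by ring

end Offsets

section Average

variable {N R : ℕ} [NeZero N] [NeZero R] {M : Fin d → ℕ} [hM : ∀ μ, NeZero (M μ)]
variable {o : Type*} [Fintype o] [DecidableEq o]

omit [NeZero N] hM in
/-- **AN AVERAGE OF VECTORS EACH WITHIN `B` OF `v` IS WITHIN `B` OF `v`**: `‖bavg w (y, c) − v‖ ≤ B` if every block member satisfies
`‖w (cpt y + off j, c) − v‖ ≤ B` (leaf-02's `CovariantLinePlanting.bavg`, the `R^{−d}`-weighted sum over the block). [folklore] -/
theorem norm_bavg_sub_le (w : Tor (fine (R * N) M) × Fin d → Matrix o o ℂ) (i : Tor (fine N M) × Fin d) (v : Matrix o o ℂ)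
    {B : ℝ} (hB : ∀ j : Fin d → Fin R, ‖w (cpt N R M i.1 + off N R M j, i.2) - v‖ ≤ B) : ‖bavg N R M w i - v‖ ≤ B := by
  have hR : (0 : ℝ) < R := by exact_mod_cast Nat.pos_of_ne_zero (NeZero.ne R)
  have hRd : ((R : ℂ) ^ d) ≠ 0 := pow_ne_zero _ (by exact_mod_cast NeZero.ne R)
  have hcard : (Finset.univ : Finset (Fin d → Fin R)).card = R ^ d := by
    rw [Finset.card_univ, Fintype.card_fun, Fintype.card_fin, Fintype.card_fin]
  have hv : ((R : ℂ) ^ d)⁻¹ • ∑ _j : Fin d → Fin R, v = v := by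
    rw [Finset.sum_const, hcard, ← Nat.cast_smul_eq_nsmul ℂ, smul_smul, Nat.cast_pow, inv_mul_cancel₀ hRd, one_smul]
  have e : bavg N R M w i - v = ((R : ℂ) ^ d)⁻¹ • ∑ j : Fin d → Fin R, (w (cpt N R M i.1 + off N R M j, i.2) - v) := by
    rw [Finset.sum_sub_distrib, smul_sub, hv, bavg]
  rw [e, norm_smul, norm_inv, norm_pow, Complex.norm_natCast]
  calc ((R : ℝ) ^ d)⁻¹ * ‖∑ j : Fin d → Fin R, (w (cpt N R M i.1 + off N R M j, i.2) - v)‖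
      ≤ ((R : ℝ) ^ d)⁻¹ * ∑ j : Fin d → Fin R, ‖w (cpt N R M i.1 + off N R M j, i.2) - v‖ :=
        mul_le_mul_of_nonneg_left (norm_sum_le _ _) (by positivity)
    _ ≤ ((R : ℝ) ^ d)⁻¹ * ∑ _j : Fin d → Fin R, B := mul_le_mul_of_nonneg_left (Finset.sum_le_sum fun j _ => hB j) (by positivity)
    _ = B := by
        rw [Finset.sum_const, hcard, nsmul_eq_mul, Nat.cast_pow, ← mul_assoc, inv_mul_cancel₀ (pow_ne_zero _ hR.ne'), one_mul]

end Average

/-! ## §2 Along the tower: oscillation against the block average at the parent, and the two readings of consistency -/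

section Tower

variable (L : ℕ) [NeZero L] (M : Fin d → ℕ) [hM : ∀ μ, NeZero (M μ)]
variable {o : Type*} [Fintype o] [DecidableEq o]
variable {W : (k : ℕ) → Fin d → (idx L M k → Matrix o o ℂ)}

/-- the level-`(k+1)` Lipschitz constant `β/lev L (k+1)` times the block's ℓ¹-size `d·L` is `d·β/lev L k`. [folklore] -/
theorem d_mul_L_mul_lip_succ (β : ℝ) (k : ℕ) : (d : ℝ) * L * (β / (lev L (k + 1) : ℕ)) = d * β / (lev L k : ℕ) := by
  have hL : (L : ℝ) ≠ 0 := by exact_mod_cast NeZero.ne L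
  rw [lev_succ', Nat.cast_mul]
  field_simp

/-- **INTRA-BLOCK OSCILLATION AGAINST THE BLOCK AVERAGE AT THE PARENT** from the (3.35)-Lipschitz SHAPE: if
`‖W k μ (x + e_ν) − W k μ x‖ ≤ β/lev L k` at every level, then for every fine index `x′` of level `k+1`
`‖W (k+1) μ x′ − bavg (W (k+1) μ) (parT x′)‖ ≤ 2dβ/lev L k`. [folklore] -/
theorem norm_sub_bavg_parT_le {β : ℝ} (hβ : 0 ≤ β)
    (hlip : ∀ k μ ν (i : idx L M k), ‖W k μ (tau (fine (lev L k) M) ν i) - W k μ i‖ ≤ β / (lev L k : ℕ))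
    (k : ℕ) (μ : Fin d) (x' : idx L M (k + 1)) :
    ‖W (k + 1) μ x' - bavg (lev L k) L M (W (k + 1) μ) (parT (lev L k) L M x')‖ ≤ 2 * (d * β / (lev L k : ℕ)) := by
  have hlip0 : 0 ≤ β / (lev L (k + 1) : ℕ) := div_nonneg hβ (Nat.cast_nonneg _)
  rw [norm_sub_rev]
  refine norm_bavg_sub_le (W (k + 1) μ) (parT (lev L k) L M x') (W (k + 1) μ x') fun j => ?_
  -- `x′ = cpt (par x′) + off (rem x′)` is itself a block member
  have hx : x' = (cpt (lev L k) L M (par (lev L k) L M x'.1) + off (lev L k) L M (rem (lev L k) L M x'.1), x'.2) :=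
    Prod.ext (cpt_par_add_off_rem (lev L k) L M x'.1).symm rfl
  have h := norm_sub_of_block_le (W (k + 1) μ) hlip0 (hlip (k + 1) μ) (par (lev L k) L M x'.1) x'.2 j (rem (lev L k) L M x'.1)
  rw [← hx] at h
  rw [← d_mul_L_mul_lip_succ L]
  exact h

/-- **«BLOCK-AVERAGE READING ⟹ PARENT-BOND READING»** (NE3-(E)'s comparison ⟹ the `hcons`/`consistent` shape rows B5/B6 consume): Lipschitz
`β` + `‖bavg (W (k+1) μ) y − W k μ y‖ ≤ γ/lev L k` ⟹ `‖W (k+1) μ x′ − W k μ (parT x′)‖ ≤ (γ + 2dβ)/lev L k`. [folklore] -/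
theorem consistent_of_bavg_consistent {β γ : ℝ} (hβ : 0 ≤ β)
    (hlip : ∀ k μ ν (i : idx L M k), ‖W k μ (tau (fine (lev L k) M) ν i) - W k μ i‖ ≤ β / (lev L k : ℕ))
    (hbavg : ∀ k μ (y : idx L M k), ‖bavg (lev L k) L M (W (k + 1) μ) y - W k μ y‖ ≤ γ / (lev L k : ℕ))
    (k : ℕ) (μ : Fin d) (x' : idx L M (k + 1)) :
    ‖W (k + 1) μ x' - W k μ (parT (lev L k) L M x')‖ ≤ (γ + 2 * d * β) / (lev L k : ℕ) := by
  calc ‖W (k + 1) μ x' - W k μ (parT (lev L k) L M x')‖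
      ≤ ‖W (k + 1) μ x' - bavg (lev L k) L M (W (k + 1) μ) (parT (lev L k) L M x')‖
          + ‖bavg (lev L k) L M (W (k + 1) μ) (parT (lev L k) L M x') - W k μ (parT (lev L k) L M x')‖ :=
        norm_sub_le_norm_sub_add_norm_sub _ _ _
    _ ≤ 2 * (d * β / (lev L k : ℕ)) + γ / (lev L k : ℕ) := add_le_add (norm_sub_bavg_parT_le L M hβ hlip k μ x') (hbavg k μ _)
    _ = (γ + 2 * d * β) / (lev L k : ℕ) := by ring

/-- **«PARENT-BOND READING ⟹ BLOCK-AVERAGE READING»** (NO Lipschitz input): `‖W (k+1) μ x′ − W k μ (parT x′)‖ ≤ βc/lev L k` for all fine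
`x′` ⟹ `‖bavg (W (k+1) μ) y − W k μ y‖ ≤ βc/lev L k` for every coarse `y` (every block member has parent `y`). [folklore] -/
theorem bavg_consistent_of_consistent {βc : ℝ}
    (hcons : ∀ k μ (x' : idx L M (k + 1)), ‖W (k + 1) μ x' - W k μ (parT (lev L k) L M x')‖ ≤ βc / (lev L k : ℕ))
    (k : ℕ) (μ : Fin d) (y : idx L M k) :
    ‖bavg (lev L k) L M (W (k + 1) μ) y - W k μ y‖ ≤ βc / (lev L k : ℕ) := by
  refine norm_bavg_sub_le (W (k + 1) μ) y (W k μ y) fun j => ?_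
  have hpar : parT (lev L k) L M ((cpt (lev L k) L M y.1 + off (lev L k) L M j, y.2) : idx L M (k + 1)) = y :=
    Prod.ext (par_cpt_add_off (lev L k) L M y.1 j) rfl
  have h := hcons k μ ((cpt (lev L k) L M y.1 + off (lev L k) L M j, y.2) : idx L M (k + 1))
  rwa [hpar] at h

end Tower

/-! ## §3 In node U1b's currency: `LocalRate (bgReadings 𝒟) · L⁻¹` from / to the block-average reading -/

section Currency

variable (L : ℕ) [NeZero L] (M : Fin d → ℕ) [hM : ∀ μ, NeZero (M μ)]
variable {o : Type*} [Fintype o] [DecidableEq o]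
variable {𝒟 : Set ((k : ℕ) → Fin d → (idx L M k → Matrix o o ℂ))}

/-- **BLOCK-AVERAGE CONSISTENCY + LIPSCHITZ ⟹ ROOT B's BINDER SHAPE**: if every tower of the class `𝒟` is lattice-Lipschitz with `β/lev L k`
and block-average consistent with `γ/lev L k`, then `LocalRate (bgReadings L M 𝒟) (γ + 2dβ) L⁻¹` (`NE2FromNE3.localRate_of_consistent` BY NAME).
[folklore] -/
theorem localRate_of_bavg_consistent {β γ : ℝ} (hβ : 0 ≤ β)
    (hlip : ∀ W ∈ 𝒟, ∀ k μ ν (i : idx L M k), ‖W k μ (tau (fine (lev L k) M) ν i) - W k μ i‖ ≤ β / (lev L k : ℕ))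
    (hbavg : ∀ W ∈ 𝒟, ∀ k μ (y : idx L M k), ‖bavg (lev L k) L M (W (k + 1) μ) y - W k μ y‖ ≤ γ / (lev L k : ℕ)) :
    LocalRate (bgReadings L M 𝒟) (γ + 2 * d * β) ((L : ℝ)⁻¹) :=
  localRate_of_consistent L M fun W hW k ν x' => consistent_of_bavg_consistent L M hβ (hlip W hW) (hbavg W hW) k ν x'

/-- **ROOT B's BINDER ⟹ BLOCK-AVERAGE CONSISTENCY** for every member of the class, constant `2·card o·C` (`NE2FromNE3.consistent_of_localRate_lev`
BY NAME; no Lipschitz input). [folklore] -/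
theorem bavg_consistent_of_localRate {C : ℝ} (hC : 0 ≤ C) (h : LocalRate (bgReadings L M 𝒟) C ((L : ℝ)⁻¹))
    {W : (k : ℕ) → Fin d → (idx L M k → Matrix o o ℂ)} (hW : W ∈ 𝒟) (k : ℕ) (μ : Fin d) (y : idx L M k) :
    ‖bavg (lev L k) L M (W (k + 1) μ) y - W k μ y‖ ≤ (2 * (Fintype.card o : ℝ) * C) / (lev L k : ℕ) :=
  bavg_consistent_of_consistent L M (fun k μ x' => consistent_of_localRate_lev L M hC h hW k μ x') k μ y

end Currency

/-! ## §4 Row B5's instance: the connection tower of a `RegularTransporters` family, and the class `regClass` -/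

section RowB5

variable (L : ℕ) [NeZero L] (M : Fin d → ℕ) [hM : ∀ μ, NeZero (M μ)]
variable {o : Type*} [Fintype o] [DecidableEq o]
variable {R : (k : ℕ) → Fin d → (idx L M k → Matrix o o ℂ)} {α β : ℝ}

/-- **THE CONNECTION TOWER's INTRA-BLOCK OSCILLATION** under row B5's (3.35)-shape class: `‖w_{k+1}(x′) − bavg(w_{k+1})(parT x′)‖ ≤ 2dβ/lev L k`.
[cite: Balaban1985BackgroundPropagators, (3.35) p.396 (shape)] [folklore] -/
theorem connTower_sub_bavg_parT_le (h : RegularTransporters L M R α β) (k : ℕ) (μ : Fin d) (x' : idx L M (k + 1)) :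
    ‖connTower L M R (k + 1) μ x' - bavg (lev L k) L M (connTower L M R (k + 1) μ) (parT (lev L k) L M x')‖ ≤ 2 * (d * β / (lev L k : ℕ)) :=
  norm_sub_bavg_parT_le L M h.nonneg.2 (fun k μ ν i => connTower_lipschitz h k μ ν i) k μ x'

/-- **(M2′) FOR THE CONNECTION TOWER**: block-average consistency `‖bavg(w_{k+1})(y) − w_k(y)‖ ≤ γ/lev L k` of a `RegularTransporters L M R α β`
family gives the parent-bond consistency `‖w_{k+1}(x′) − w_k(parT x′)‖ ≤ (γ + 2dβ)/lev L k` — the `hcons` input of rows B5/B6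
(`RegularBackgroundTower.lipschitzBackgroundM_of_regular`, `NE2FromNE3.localRate_of_consistent`). [folklore] -/
theorem connTower_consistent_of_bavg (h : RegularTransporters L M R α β) {γ : ℝ}
    (hbavg : ∀ k μ (y : idx L M k), ‖bavg (lev L k) L M (connTower L M R (k + 1) μ) y - connTower L M R k μ y‖ ≤ γ / (lev L k : ℕ))
    (k : ℕ) (μ : Fin d) (x' : idx L M (k + 1)) :
    ‖connTower L M R (k + 1) μ x' - connTower L M R k μ (parT (lev L k) L M x')‖ ≤ (γ + 2 * d * β) / (lev L k : ℕ) :=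
  consistent_of_bavg_consistent L M h.nonneg.2 (fun k μ ν i => connTower_lipschitz h k μ ν i) hbavg k μ x'

/-- **ROOT B's `hNE3` ⟹ THE BLOCK-AVERAGE READING FOR BOTH TOWERS OF `regClass R = {w, D_νw_ν}`** (no Lipschitz input, no class structure needed).
[folklore] -/
theorem bavg_consistent_regClass_of_localRate {C : ℝ} (hC : 0 ≤ C) (hNE3 : LocalRate (bgReadings L M (regClass L M R)) C ((L : ℝ)⁻¹))
    (k : ℕ) (μ : Fin d) (y : idx L M k) :
    ‖bavg (lev L k) L M (connTower L M R (k + 1) μ) y - connTower L M R k μ y‖ ≤ (2 * (Fintype.card o : ℝ) * C) / (lev L k : ℕ)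
      ∧ ‖bavg (lev L k) L M (dconnTower L M R (k + 1) μ) y - dconnTower L M R k μ y‖ ≤ (2 * (Fintype.card o : ℝ) * C) / (lev L k : ℕ) :=
  ⟨bavg_consistent_of_localRate L M hC hNE3 (by simp [regClass]) k μ y,
    bavg_consistent_of_localRate L M hC hNE3 (by simp [regClass]) k μ y⟩

/-- **THE BLOCK-AVERAGE READING ⟹ ROOT B's `hNE3` ON `regClass R`**, DISPLAYING the one input row B5's structure does not carry: a lattice-Lipschitz
bound `hlipD` on the DERIVATIVE tower `D_νw_ν` (a second-difference ∕ (3.36)-type shape; the connection tower's Lipschitz bound IS the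
`lipschitz` field of `RegularTransporters`).  Conclusion: `LocalRate (bgReadings L M (regClass L M R)) (γ + 2d·max β βD) L⁻¹`. [folklore] -/
theorem localRate_regClass_of_bavg_consistent (h : RegularTransporters L M R α β) {βD γ : ℝ} (hβD : 0 ≤ βD)
    (hlipD : ∀ k μ ν (i : idx L M k),
      ‖dconnTower L M R k μ (tau (fine (lev L k) M) ν i) - dconnTower L M R k μ i‖ ≤ βD / (lev L k : ℕ))
    (hbavg : ∀ k μ (y : idx L M k), ‖bavg (lev L k) L M (connTower L M R (k + 1) μ) y - connTower L M R k μ y‖ ≤ γ / (lev L k : ℕ))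
    (hbavgD : ∀ k μ (y : idx L M k), ‖bavg (lev L k) L M (dconnTower L M R (k + 1) μ) y - dconnTower L M R k μ y‖ ≤ γ / (lev L k : ℕ)) :
    LocalRate (bgReadings L M (regClass L M R)) (γ + 2 * d * max β βD) ((L : ℝ)⁻¹) := by
  refine localRate_of_bavg_consistent L M (hβD.trans (le_max_right β βD)) (fun W hW k μ ν i => ?_) (fun W hW k μ y => ?_)
  · rcases hW with rfl | rfl
    · exact (connTower_lipschitz h k μ ν i).trans (div_le_div_of_nonneg_right (le_max_left β βD) (Nat.cast_nonneg _))
    · exact (hlipD k μ ν i).trans (div_le_div_of_nonneg_right (le_max_right β βD) (Nat.cast_nonneg _))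
  · rcases hW with rfl | rfl
    · exact hbavg k μ y
    · exact hbavgD k μ y

end RowB5

end Summit.QuantumFields.BalabanUV.T4Continuum.NE2FromNE3BavgBridge

end
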